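import Literature.Analysis.FluidPDE.VectorCalculus

/-!
# Rigidity of the normal-variation test class: `C²` normal fields only see directions in which the curvature vector is differentiable

Refutation-first lane `ns-filament-19175-p1`, third cut (2026-08-27), crux `TransverseReductionR`
(stmt-NavierStokesRegularity-19175) / `SelectionBoxR` (stmt-19174).  Clause 13 of the shared box block (the
normal-variation / non-degeneracy clause) quantifies over test families `Y : Fin N → ℝ → ℝ³` that are
`C²` AND pointwise normal to the `C²` unit-speed filaments `X_j` (`⟪Y_j τ, X_j′ τ⟫ = 0`).  The filaments are
only `C²`: their tangent `X_j′` is `C¹` and their curvature vector `X_j″` merely continuous.  This file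
records the elementary mechanism that makes the admissible class depend on the FINE regularity of the
filament beyond `C²` (route-independent; no `Theses` import):

* `inner_iteratedDeriv_two_eq_neg` — along a `C²` curve, a `C¹` normal field satisfies
  `⟪Y τ, X″ τ⟫ = −⟪Y′ τ, X′ τ⟫` (differentiate `⟪Y, X′⟫ ≡ 0`).
* `differentiableAt_inner_const_iteratedDeriv_two` — if `Y` is a `C²` normal field then, at every `τ₀`,
  the scalar `τ ↦ ⟪Y τ₀, X″ τ⟫` is differentiable at `τ₀`: an admissible test field only points in directions
  in which the curvature vector is differentiable.
* `normalField_apply_eq_zero_of_rough`, `normalField_eq_zero_of_rough_dense` — consequently, at a point where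
  `τ ↦ ⟪e, X″ τ⟫` is non-differentiable for every non-zero normal vector `e` ("normally rough" point), every
  admissible `Y` vanishes; on the closure of a set of such points `Y ≡ 0`.
* `clause13_of_rough` — clause 13 VERBATIM (any `N`, `a`, `b`, any `T`, `cnd ≥ 0`) HOLDS for every filament
  family each of whose members is normally rough on a dense set: the admissible class is `{0}` and the clause
  is idle.  This is the failure mode opposite to the junk directions of
  `FilamentSkeletonRssNormalVariationJunkDeriv.lean` (clause 13 trivially VIOLATED for `b ≥ 1` along smooth
  oscillating tails): beyond the tangency ball the box clauses leave the filaments free to be `C² ∖ C³`, and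
  there the clause is trivially SATISFIED.  Planner-facing consequence (evidence `TESTS-19175-g3.md` on the
  item): no census of the exponent `b` can be obtained from junk (rough tails defeat the switch-off), and as
  typed the clause constrains a witness only through test fields supported over the smooth (in-ball) portion.
* `admissible_cross_of_contDiff_three` — conversely, along a `C³` filament the class is non-trivial
  (`Y = X′ × e` is a `C²` normal field).

Negative-side bookkeeping for the crux (`--supports` stmt-19175); NOT a claim about NS regularity or blow-up.
-/

set_option linter.dupNamespace false

noncomputable section

namespace Summit.NavierStokesRegularity.NavierStokesRegularity.Theorems

open Set Function Filter Real Asymptotics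
open Literature.Analysis.FluidPDE
open scoped InnerProductSpace Topology

namespace NormalVariationRigidity

variable {E : Type*} [NormedAddCommGroup E] [InnerProductSpace ℝ E]

/-- `iteratedDeriv 2 X = deriv (deriv X)`. [folklore] -/
theorem iteratedDeriv_two_eq (X : ℝ → E) : iteratedDeriv 2 X = deriv (deriv X) := by
  rw [iteratedDeriv_succ, iteratedDeriv_one]

/-- Along a `C²` curve `X`, a `C¹` field `Y` with `⟪Y, X′⟫ ≡ 0` has `⟪Y τ, X″ τ⟫ = −⟪Y′ τ, X′ τ⟫`
(differentiate the identity). [folklore] -/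
theorem inner_iteratedDeriv_two_eq_neg {X Y : ℝ → E} (hX : ContDiff ℝ 2 X) (hY : ContDiff ℝ 1 Y)
    (hperp : ∀ τ, ⟪Y τ, deriv X τ⟫_ℝ = 0) (τ : ℝ) :
    ⟪Y τ, iteratedDeriv 2 X τ⟫_ℝ = -⟪deriv Y τ, deriv X τ⟫_ℝ := by
  have hX1 : Differentiable ℝ (deriv X) := by
    have := hX.differentiable_iteratedDeriv 1 (by norm_num)
    rwa [iteratedDeriv_one] at this
  have hY1 : Differentiable ℝ Y := hY.differentiable (by norm_num)
  have h := (hY1 τ).hasDerivAt.inner ℝ (hX1 τ).hasDerivAt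
  -- the product is identically zero, so its derivative vanishes
  have h0 : deriv (fun t => ⟪Y t, deriv X t⟫_ℝ) τ = 0 := by
    have : (fun t => ⟪Y t, deriv X t⟫_ℝ) = fun _ => (0:ℝ) := funext hperp
    rw [this, deriv_const]
  rw [h.deriv] at h0
  rw [iteratedDeriv_two_eq]
  linarith

/-- **Rigidity of the test class.** If `X` is `C²` and `Y` is a `C²` field normal to it
(`⟪Y τ, X′ τ⟫ = 0` for all `τ`), then for every `τ₀` the scalar function `τ ↦ ⟪Y τ₀, X″ τ⟫` is
differentiable at `τ₀`: admissible test fields of clause 13 only point in directions in which the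
curvature vector `X″` is differentiable.  (`⟪Y τ, X″ τ⟫ = −⟪Y′ τ, X′ τ⟫` is `C¹`, and
`⟪Y τ − Y τ₀, X″ τ⟫` is differentiable at `τ₀` because `Y τ − Y τ₀ = O(τ − τ₀)` and `X″` is continuous.)
[folklore] -/
theorem differentiableAt_inner_const_iteratedDeriv_two {X Y : ℝ → E} (hX : ContDiff ℝ 2 X)
    (hY : ContDiff ℝ 2 Y) (hperp : ∀ τ, ⟪Y τ, deriv X τ⟫_ℝ = 0) (τ₀ : ℝ) :
    DifferentiableAt ℝ (fun τ => ⟪Y τ₀, iteratedDeriv 2 X τ⟫_ℝ) τ₀ := by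
  have hX1 : Differentiable ℝ (deriv X) := by
    have := hX.differentiable_iteratedDeriv 1 (by norm_num)
    rwa [iteratedDeriv_one] at this
  have hX2c : Continuous (iteratedDeriv 2 X) := hX.continuous_iteratedDeriv 2 le_rfl
  have hY0 : Differentiable ℝ Y := hY.differentiable (by norm_num)
  have hY1 : Differentiable ℝ (deriv Y) := by
    have := hY.differentiable_iteratedDeriv 1 (by norm_num)
    rwa [iteratedDeriv_one] at this
  -- (1) `τ ↦ ⟪Y τ, X″ τ⟫ = -⟪Y′ τ, X′ τ⟫` is differentiable
  have h1 : DifferentiableAt ℝ (fun τ => ⟪Y τ, iteratedDeriv 2 X τ⟫_ℝ) τ₀ := by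
    have heq : (fun τ => ⟪Y τ, iteratedDeriv 2 X τ⟫_ℝ) = fun τ => -⟪deriv Y τ, deriv X τ⟫_ℝ :=
      funext (inner_iteratedDeriv_two_eq_neg hX (hY.of_le (by norm_num)) hperp)
    rw [heq]
    exact ((hY1 τ₀).inner ℝ (hX1 τ₀)).neg
  -- (2) `τ ↦ ⟪Y τ - Y τ₀, X″ τ - X″ τ₀⟫` has derivative `0` at `τ₀`
  set A : ℝ → E := fun τ => Y τ - Y τ₀ with hA
  set B : ℝ → E := fun τ => iteratedDeriv 2 X τ - iteratedDeriv 2 X τ₀ with hB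
  have hAO : A =O[𝓝 τ₀] fun τ => τ - τ₀ := (hY0 τ₀).isBigO_sub
  have hBo : B =o[𝓝 τ₀] fun _ => (1:ℝ) := by
    rw [isLittleO_one_iff]
    have : Tendsto (iteratedDeriv 2 X) (𝓝 τ₀) (𝓝 (iteratedDeriv 2 X τ₀)) := hX2c.continuousAt
    simpa [hB] using this.sub_const (iteratedDeriv 2 X τ₀)
  have h3 : (fun τ => ‖A τ‖ * ‖B τ‖) =o[𝓝 τ₀] fun τ => (τ - τ₀) * (1:ℝ) :=
    hAO.norm_left.mul_isLittleO hBo.norm_left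
  have h4 : (fun τ => ⟪A τ, B τ⟫_ℝ) =O[𝓝 τ₀] fun τ => ‖A τ‖ * ‖B τ‖ := by
    refine IsBigO.of_bound 1 (Eventually.of_forall fun τ => ?_)
    rw [one_mul, Real.norm_eq_abs, Real.norm_eq_abs, abs_mul, abs_norm, abs_norm]
    exact abs_real_inner_le_norm _ _
  have h5 : (fun τ => ⟪A τ, B τ⟫_ℝ) =o[𝓝 τ₀] fun τ => τ - τ₀ := by
    simpa only [mul_one] using h4.trans_isLittleO h3
  have h2 : HasDerivAt (fun τ => ⟪A τ, B τ⟫_ℝ) 0 τ₀ := by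
    rw [hasDerivAt_iff_isLittleO]
    refine h5.congr' (Eventually.of_forall fun τ => ?_) EventuallyEq.rfl
    simp [hA]
  -- (3) `τ ↦ ⟪Y τ - Y τ₀, X″ τ₀⟫` is differentiable
  have h6 : DifferentiableAt ℝ (fun τ => ⟪A τ, iteratedDeriv 2 X τ₀⟫_ℝ) τ₀ :=
    ((hY0 τ₀).sub_const (Y τ₀)).inner ℝ (differentiableAt_const _)
  -- assemble: `⟪Y τ₀, X″ τ⟫ = ⟪Y τ, X″ τ⟫ - (⟪A τ, B τ⟫ + ⟪A τ, X″ τ₀⟫)`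
  have heq : (fun τ => ⟪Y τ₀, iteratedDeriv 2 X τ⟫_ℝ) = fun τ =>
      ⟪Y τ, iteratedDeriv 2 X τ⟫_ℝ - (⟪A τ, B τ⟫_ℝ + ⟪A τ, iteratedDeriv 2 X τ₀⟫_ℝ) := by
    funext τ
    simp only [hA, hB, inner_sub_left, inner_sub_right]
    ring
  rw [heq]
  exact h1.sub (h2.differentiableAt.add h6)

/-- **Normally rough points kill the test class.** If at `τ₀` the curvature vector of the `C²` curve
`X` is non-differentiable against every non-zero normal direction (`τ ↦ ⟪e, X″ τ⟫` not differentiable at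
`τ₀` whenever `e ≠ 0`, `e ⊥ X′ τ₀`), then every `C²` normal field `Y` vanishes at `τ₀`. [folklore] -/
theorem normalField_apply_eq_zero_of_rough {X Y : ℝ → E} (hX : ContDiff ℝ 2 X) (hY : ContDiff ℝ 2 Y)
    (hperp : ∀ τ, ⟪Y τ, deriv X τ⟫_ℝ = 0) {τ₀ : ℝ}
    (hrough : ∀ e : E, ⟪e, deriv X τ₀⟫_ℝ = 0 → e ≠ 0 →
      ¬ DifferentiableAt ℝ (fun τ => ⟪e, iteratedDeriv 2 X τ⟫_ℝ) τ₀) :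
    Y τ₀ = 0 := by
  by_contra h
  exact hrough (Y τ₀) (hperp τ₀) h (differentiableAt_inner_const_iteratedDeriv_two hX hY hperp τ₀)

/-- If the `C²` curve `X` is normally rough on a DENSE set `D`, every `C²` normal field along it vanishes
identically (it vanishes on `D` and is continuous). [folklore] -/
theorem normalField_eq_zero_of_rough_dense {X Y : ℝ → E} (hX : ContDiff ℝ 2 X) (hY : ContDiff ℝ 2 Y)
    (hperp : ∀ τ, ⟪Y τ, deriv X τ⟫_ℝ = 0) {D : Set ℝ} (hD : Dense D)
    (hrough : ∀ τ₀ ∈ D, ∀ e : E, ⟪e, deriv X τ₀⟫_ℝ = 0 → e ≠ 0 →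
      ¬ DifferentiableAt ℝ (fun τ => ⟪e, iteratedDeriv 2 X τ⟫_ℝ) τ₀) :
    Y = 0 := by
  have hcl : IsClosed {τ : ℝ | Y τ = 0} := isClosed_eq (hY.continuous) continuous_const
  have hsub : D ⊆ {τ : ℝ | Y τ = 0} := fun τ₀ hτ₀ =>
    normalField_apply_eq_zero_of_rough hX hY hperp (hrough τ₀ hτ₀)
  have huniv : {τ : ℝ | Y τ = 0} = univ := by
    apply eq_univ_of_univ_subset
    rw [← hD.closure_eq]
    exact hcl.closure_subset_iff.2 hsub
  funext τ
  have : τ ∈ {τ : ℝ | Y τ = 0} := by rw [huniv]; trivial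
  exact this

/-- **Clause 13 is idle on normally rough filament families.** The normal-variation clause of the box
block of `TransverseReductionR`/`SelectionBoxR`, VERBATIM (any number `N` of filaments, any exponents
`a`, `b`, any `cnd ≥ 0`, any map `T`, any centres `c`): if each filament `X_j` is `C²` and normally rough on
a dense set, the only admissible test family is `Y = 0` and the clause HOLDS — it then expresses no
non-degeneracy whatsoever.  (With `Y = 0` the premise at any `(j, τ)` reads `0 ≤ L (1+|τ−c_j|)^a`, so
`L ≥ 0` and the conclusion `0 ≤ cnd L (1+|τ−c_j|)^b` holds.) [folklore] -/
theorem clause13_of_rough {N : ℕ} {a b cnd : ℝ} (hcnd : 0 ≤ cnd)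
    {X : Fin N → ℝ → EuclideanSpace ℝ (Fin 3)} {c : Fin N → ℝ}
    (T : (Fin N → ℝ → EuclideanSpace ℝ (Fin 3)) → Fin N → ℝ → EuclideanSpace ℝ (Fin 3))
    (hX : ∀ j, ContDiff ℝ 2 (X j)) {D : Fin N → Set ℝ} (hD : ∀ j, Dense (D j))
    (hrough : ∀ j, ∀ τ₀ ∈ D j, ∀ e : EuclideanSpace ℝ (Fin 3), ⟪e, deriv (X j) τ₀⟫_ℝ = 0 → e ≠ 0 →
      ¬ DifferentiableAt ℝ (fun τ => ⟪e, iteratedDeriv 2 (X j) τ⟫_ℝ) τ₀) :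
    ∀ Y : Fin N → ℝ → EuclideanSpace ℝ (Fin 3), (∀ j, ContDiff ℝ 2 (Y j)) →
      (∀ j τ, ⟪Y j τ, deriv (X j) τ⟫_ℝ = 0) →
      ∑ j, ⟪Y j (c j), cross (EuclideanSpace.single 2 1) (X j (c j))⟫_ℝ = 0 →
      (∀ j τ, ‖Y j τ‖ + ‖deriv (Y j) τ‖ + ‖iteratedDeriv 2 (Y j) τ‖ ≤ (1 + |τ - c j|) ^ b) →
      ∀ L : ℝ, (∀ j τ, ‖deriv (fun s : ℝ => T (fun k σ => X k σ + s • Y k σ) j τ) 0‖ ≤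
        L * (1 + |τ - c j|) ^ a) →
      ∀ j τ, ‖Y j τ‖ ≤ cnd * L * (1 + |τ - c j|) ^ b := by
  intro Y hY hperp _ _ L hL j τ
  -- every admissible component vanishes identically
  have hY0 : ∀ k, Y k = 0 := fun k =>
    normalField_eq_zero_of_rough_dense (hX k) (hY k) (hperp k) (hD k) (hrough k)
  -- hence the perturbed family is `X` itself and the premise forces `0 ≤ L`
  have hfam : (fun s : ℝ => T (fun k σ => X k σ + s • Y k σ) j τ) = fun _ => T X j τ := by
    funext s
    have : (fun k σ => X k σ + s • Y k σ) = X := by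
      funext k σ; rw [hY0 k]; simp
    rw [this]
  have hLτ := hL j τ
  rw [hfam, deriv_const, norm_zero] at hLτ
  have hpos : 0 < (1 + |τ - c j|) ^ a := Real.rpow_pos_of_pos (by positivity) a
  have hL0 : 0 ≤ L := by
    by_contra hneg
    exact absurd hLτ (not_le.2 (mul_neg_of_neg_of_pos (not_le.1 hneg) hpos))
  rw [hY0 j]
  simp only [Pi.zero_apply, norm_zero]
  exact mul_nonneg (mul_nonneg hcnd hL0) (Real.rpow_nonneg (by positivity) b)

/-- `⟪a × b, a⟫ = 0`. [folklore] -/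
theorem inner_cross_self_left (a b : EuclideanSpace ℝ (Fin 3)) : ⟪cross a b, a⟫_ℝ = 0 := by
  simp [cross, crossProduct, PiLp.inner_apply, Fin.sum_univ_three]
  ring

/-- **Conversely, `C³` filaments carry a non-trivial test class.** Along a `C³` curve `X` the field
`Y = X′ × e` (any fixed vector `e`) is a `C²` normal field; so the admissible class of clause 13 is
non-trivial exactly as far as the tangent is `C²` — the clause tests fine regularity of the witness, not
only its geometry. [folklore] -/
theorem admissible_cross_of_contDiff_three {X : ℝ → EuclideanSpace ℝ (Fin 3)} (hX : ContDiff ℝ 3 X)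
    (e : EuclideanSpace ℝ (Fin 3)) :
    ContDiff ℝ 2 (fun τ => cross (deriv X τ) e) ∧ ∀ τ, ⟪cross (deriv X τ) e, deriv X τ⟫_ℝ = 0 := by
  refine ⟨?_, fun τ => inner_cross_self_left _ _⟩
  have hX1 : ContDiff ℝ 2 (deriv X) := by
    have h3 : ContDiff ℝ ((2 : ℕ) + 1 : ℕ) X := by simpa using hX
    exact h3.deriv'
  have hcr : ContDiff ℝ 2 fun p : EuclideanSpace ℝ (Fin 3) => cross p e := by
    have : (fun p : EuclideanSpace ℝ (Fin 3) => cross p e) = fun p => crossCLM.flip e p := by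
      funext p; simp [ContinuousLinearMap.flip_apply]
    rw [this]
    exact (crossCLM.flip e).contDiff
  exact hcr.comp hX1

end NormalVariationRigidity

end Summit.NavierStokesRegularity.NavierStokesRegularity.Theorems
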